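import Literature.NumberTheory.Automorphic.CuspidalCohomologyGLHecke
import Literature.AlgebraicTopology.SingularHomology.ChainSubcomplex
import Mathlib.Combinatorics.Quiver.ReflQuiver
import HarnessLib

/-!
# Restriction to the boundary is Hecke-equivariant; interior classes for a discrete Tits building

Topic `NumberTheory/Automorphic`; namespace `Literature.NumberTheory.Automorphic.TwistedQuotient` (the
generic layer of `CuspidalCohomologyGL`: `ι : Γ →* 𝒢`, level `L ≤ 𝒢`, representation `ρ : Γ → GL(V)`,
poset `P` of proper rational parabolics with a monotone `Γ`-action, `cohomology ι L ρ q = H^q(S_L, Ṽ)`,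
boundary cochains `bdryRep ι L ρ P hP p = Fun(N(P)_p × 𝒢/L, V)`, coaugmentation `coaugHom`, interior
cohomology `interiorCohomology ι L ρ P hP q = H^q_!`).  A *proofs* file (definitions with bodies and
theorems; no named fact, no instance), supporting
`Literature.NumberTheory.Automorphic.bianchi_boundaryEigensystem_isReducible` (first step of its
printed proof: "the restriction map is Hecke-equivariant, so the eigensystem [of a non-interior class]
occurs in `H^q(∂X̄_U, Ṽ_wt)`", Harder 1987, Introduction and §1; Khare–Thorne 2017, proof of Thm. 6.23).

## Main definitions and results

The double-coset operator `[L g L]` on the boundary cochains `Fun(N(P)_p × 𝒢/L, V)`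
(`bdryHeckeFun`, `bdryHeckeRepHom`) and its compatibility with the coaugmentation and the coface maps
(`coaugHom_comp_bdryHeckeRepHom`, `bdryDHom_comp_bdryHeckeRepHom`) are the tree's
(`CuspidalCohomologyGLHecke`, imported).  Here:

* `bdryCohomology ι L ρ P hP q = H^q(Γ, Fun(N(P)₀ × 𝒢/L, V))`, the restriction
  `bdryRestrict … q = H^q(coaugHom) : H^q(S_L, Ṽ) → H^q(Γ, Fun(N(P)₀ × 𝒢/L, V))`, the Hecke operator
  `bdryHeckeOperator`/`bdryHeckeEnd` on the target and **Hecke-equivariance of restriction**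
  (`bdryRestrict_comp_bdryHeckeOperator`, `bdryRestrict_heckeEnd_apply`,
  `bdryHeckeEnd_bdryRestrict_of_eigen`) [Harder1987, §1] [Schwermer2010, §5.3].
* **Discrete Tits buildings.**  When `P` is an antichain (`∀ x y, x ≤ y → x = y`: every flag is a
  single parabolic, e.g. `GL₂`, where `P = ℙ¹(F)`), the boundary `∂(S_L) ≃ Γ\(P × 𝒢/L × e)` is a
  disjoint union over `Γ\P` and the double complex of `CuspidalCohomologyGL` has zero first coface map
  (`bdryD_zero_eq_zero`); hence a class is interior iff its restriction to
  `H^q(Γ, Fun(N(P)₀ × 𝒢/L, V)) = H^q(∂(S_L), Ṽ)` vanishes: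
  `isInterior_iff_bdryRestrict_eq_zero`, `mem_interiorCohomology_iff_bdryRestrict_eq_zero`,
  `bdryRestrict_ne_zero_of_not_mem_interiorCohomology` [Harder1987, §1]
  [Schwermer2010, §5.3 (H_! = ker r)].
* Auxiliary: `π_apply_eq_zero_iff_exists` — a group cocycle has zero class iff it is a coboundary
  (element form of `Hⁿ = Zⁿ/Bⁿ`, via the tree's `homologyCls` of `ChainSubcomplex`);
  `zigzagOfColumnZero` — the zig-zag `(w, 0, 0, …)`.

Not here: the identification of `H^q(Γ, Fun(P × 𝒢/L, V))` with `H^q(Stab, Fun(𝒢/L, V))` for a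
transitive action on `P` (Shapiro), and anything specific to `GL₂`.  (`Mathlib.Combinatorics.Quiver.
ReflQuiver` is imported explicitly only to keep the import closure of `CuspidalCohomologyGLHecke`
complete.)

## References

* G. Harder, *Eisenstein cohomology of arithmetic groups. The case GL₂*, Invent. Math. 89 (1987),
  Introduction and §1 [Harder1987].
* J. Schwermer, *Geometric cycles, arithmetic groups and their cohomology*, Bull. AMS 47 (2010), §5.3,
  §6, §12.2 [Schwermer2010].
* C. Khare, J. Thorne, Amer. J. Math. 139 (2017), §6.5, proof of Thm. 6.23 [KhareThorne2017].
-/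

noncomputable section

open CategoryTheory
open scoped Classical

universe u

namespace Literature.NumberTheory.Automorphic

namespace TwistedQuotient

open groupCohomology Literature.AlgebraicTopology.SingularHomology

variable {k : Type u} [CommRing k] {Γ 𝒢 : Type u} [Group Γ] [Group 𝒢]

/-! ### Classes of group cocycles: zero iff coboundary -/

section Classes

variable {A : Rep k Γ}

/-- The degree preceding `q` in the cochain complex `C^•(Γ, A)` is `q - 1` (with `0 - 1 = 0`).
[folklore] -/
theorem complexShape_up_prev (q : ℕ) : (ComplexShape.up ℕ).prev q = q - 1 := by
  cases q with
  | zero => exact CochainComplex.prev_nat_zero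
  | succ n => exact CochainComplex.prev_nat_succ n

/-- **A group cocycle has zero cohomology class iff it is a coboundary**: `π z = 0` in `H^q(Γ, A)` iff
`z = δ w` for some `(q-1)`-cochain `w` (for `q = 0`: iff `z = 0`).  Element form of `H^q = Z^q/B^q`.
[folklore] -/
theorem π_apply_eq_zero_iff_exists {q : ℕ} (z : cocycles A q) :
    (groupCohomology.π A q).hom z = 0 ↔
      ∃ w : (inhomogeneousCochains A).X (q - 1),
        ((inhomogeneousCochains A).d (q - 1) q).hom w = (iCocycles A q).hom z := by
  have hdz : ∀ j : ℕ, ((inhomogeneousCochains A).d q j).hom ((iCocycles A q).hom z) = 0 := fun j => by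
    have := LinearMap.congr_fun (congrArg ModuleCat.Hom.hom ((inhomogeneousCochains A).iCycles_d q j)) z
    simpa using this
  have hz := hdz ((ComplexShape.up ℕ).next q)
  have hmk : (inhomogeneousCochains A).cyclesMk ((iCocycles A q).hom z) (q + 1) (by simp) (hdz _) =
      z := by
    apply (ModuleCat.mono_iff_injective (iCocycles A q)).mp inferInstance
    exact (inhomogeneousCochains A).i_cyclesMk _ (q + 1) (by simp) (hdz _)
  have e : (groupCohomology.π A q).hom z =
      (homologyCls ((iCocycles A q).hom z) hz : (inhomogeneousCochains A).homology q) := by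
    unfold homologyCls scHomologyCls
    conv_lhs => rw [← hmk]
    congr 1
    apply (ModuleCat.mono_iff_injective ((inhomogeneousCochains A).sc q).iCycles).mp inferInstance
    rw [ShortComplex.moduleCatCyclesIso_inv_iCycles_apply]
    exact ((inhomogeneousCochains A).i_cyclesMk _ (q + 1) (by simp) (hdz _))
  rw [e]
  change homologyCls _ hz = (0 : (inhomogeneousCochains A).homology q) ↔ _
  rw [homologyCls_eq_zero_iff, complexShape_up_prev]

end Classes

variable (ι : Γ →* 𝒢) (L : Subgroup 𝒢) {V : Type u} [AddCommGroup V] [Module k V]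
  (ρ : Representation k Γ V) (P : Type u) [Preorder P] [MulAction Γ P]
  (hP : ∀ γ : Γ, Monotone fun x : P => γ • x)

/-! ### `H^q(Γ, Fun(N(P)₀ × 𝒢/L, V))`, the restriction map and its Hecke-equivariance -/

section Hecke

variable (g : 𝒢)

/-- **`H^q(Γ, Fun(N(P)₀ × 𝒢/L, V))`**: the cohomology of column `0` of the boundary double complex —
for a discrete building (`P` an antichain, e.g. `GL₂`) this is `H^q(∂(S_L), Ṽ)` itself, in general the
`E₁^{0,q}` term of the Tits-building spectral sequence. [cite: Schwermer2010, §5.3 and §12.2] -/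
abbrev bdryCohomology (q : ℕ) : ModuleCat k :=
  groupCohomology (bdryRep ι L ρ P hP 0) q

/-- **The restriction to the boundary** `r = H^q(coaug) : H^q(S_L, Ṽ) → H^q(Γ, Fun(N(P)₀ × 𝒢/L, V))`.
[cite: Schwermer2010, §5.3] -/
abbrev bdryRestrict (q : ℕ) : cohomology ι L ρ q ⟶ bdryCohomology ι L ρ P hP q :=
  groupCohomology.map (MonoidHom.id Γ) (coaugHom ι L ρ P hP) q

/-- The Hecke operator `T_g = [L g L]` on `H^q(Γ, Fun(N(P)₀ × 𝒢/L, V))`. [cite: Schwermer2010, §6] -/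
abbrev bdryHeckeOperator (q : ℕ) : bdryCohomology ι L ρ P hP q ⟶ bdryCohomology ι L ρ P hP q :=
  groupCohomology.map (MonoidHom.id Γ) (bdryHeckeRepHom ι L ρ P hP g 0) q

/-- The Hecke operator `T_g` on `H^q(Γ, Fun(N(P)₀ × 𝒢/L, V))` as a `k`-linear endomorphism. [folklore] -/
abbrev bdryHeckeEnd (q : ℕ) : Module.End k (bdryCohomology ι L ρ P hP q) :=
  (bdryHeckeOperator ι L ρ P hP g q).hom

/-- **Restriction to the boundary is Hecke-equivariant**: `r ∘ T_g = T_g ∘ r` on `H^q`.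
[cite: Harder1987, §1] [cite: Schwermer2010, §6] -/
theorem bdryRestrict_comp_bdryHeckeOperator (q : ℕ) :
    bdryRestrict ι L ρ P hP q ≫ bdryHeckeOperator ι L ρ P hP g q =
      heckeOperator ι L ρ g q ≫ bdryRestrict ι L ρ P hP q := by
  rw [bdryRestrict, bdryHeckeOperator, heckeOperator, ← groupCohomology.map_id_comp,
    coaugHom_comp_bdryHeckeRepHom, groupCohomology.map_id_comp]

/-- Element form of Hecke-equivariance: `r(T_g x) = T_g (r x)`. [cite: Harder1987, §1] -/
theorem bdryRestrict_heckeEnd_apply (q : ℕ) (x : cohomology ι L ρ q) :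
    (bdryRestrict ι L ρ P hP q).hom (heckeEnd ι L ρ g q x) =
      bdryHeckeEnd ι L ρ P hP g q ((bdryRestrict ι L ρ P hP q).hom x) := by
  change ((heckeOperator ι L ρ g q) ≫ bdryRestrict ι L ρ P hP q).hom x =
    (bdryRestrict ι L ρ P hP q ≫ bdryHeckeOperator ι L ρ P hP g q).hom x
  rw [bdryRestrict_comp_bdryHeckeOperator]

/-- An eigenvector of `T_g` restricts to an eigenvector of `T_g` with the same eigenvalue. [folklore] -/
theorem bdryHeckeEnd_bdryRestrict_of_eigen (q : ℕ) {x : cohomology ι L ρ q} {a : k}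
    (hx : heckeEnd ι L ρ g q x = a • x) :
    bdryHeckeEnd ι L ρ P hP g q ((bdryRestrict ι L ρ P hP q).hom x) =
      a • (bdryRestrict ι L ρ P hP q).hom x := by
  rw [← bdryRestrict_heckeEnd_apply, hx, map_smul]

end Hecke

/-! ### Discrete buildings: interior = kernel of restriction -/

section Antichain

/-- For an ANTICHAIN `P` (every flag of proper parabolics is a single parabolic, as for `GL₂`) the first
coface map `Fun(N(P)₀ × 𝒢/L, V) → Fun(N(P)₁ × 𝒢/L, V)` vanishes: both faces of a (necessarily
degenerate) `1`-simplex `x₀ ≤ x₁`, `x₀ = x₁`, coincide. [folklore] -/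
theorem bdryD_zero_eq_zero (hanti : ∀ x y : P, x ≤ y → x = y) (F : BdrySimplex L P 0 → V) :
    bdryD k L P 0 F = 0 := by
  funext s
  have hface : face L 0 0 s = face L 0 1 s := by
    refine Prod.ext (OrderHom.ext _ _ (funext fun i => ?_)) rfl
    have hi : i = 0 := Fin.eq_zero i
    subst hi
    change s.1 (Fin.succAbove 0 0) = s.1 (Fin.succAbove 1 0)
    exact (hanti _ _ (s.1.monotone (Fin.zero_le (1 : Fin 2)))).symm
  rw [bdryD_apply, Fin.sum_univ_two, hface]
  simp

/-- For an antichain `P` the coface morphism in degree `0` is zero. [folklore] -/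
theorem bdryDHom_zero_eq_zero (hanti : ∀ x y : P, x ≤ y → x = y) : bdryDHom ι L ρ P hP 0 = 0 := by
  refine Rep.hom_ext (Representation.IntertwiningMap.ext (LinearMap.ext fun F => ?_))
  change bdryD k L P 0 F = 0
  exact bdryD_zero_eq_zero L P hanti F

/-- For an antichain `P` the horizontal differential out of column `0` of the boundary double complex
vanishes on cochains. [folklore] -/
theorem bdryDCochains_zero_apply (hanti : ∀ x y : P, x ≤ y → x = y) (j : ℕ)
    (w : (inhomogeneousCochains (bdryRep ι L ρ P hP 0)).X j) :
    ((bdryDCochains ι L ρ P hP 0).f j).hom w = 0 := by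
  rw [bdryDCochains, bdryDHom_zero_eq_zero ι L ρ P hP hanti, cochainsMap_zero]
  rfl

/-- On cochains, the map induced on cocycles by the coaugmentation is the coaugmentation.
[folklore] -/
theorem iCocycles_cocyclesMap_coaugHom (q : ℕ) (z : cocycles (coeffRep ι L ρ) q) :
    (iCocycles (bdryRep ι L ρ P hP 0) q).hom
        ((cocyclesMap (MonoidHom.id Γ) (coaugHom ι L ρ P hP) q).hom z) =
      ((coaugCochains ι L ρ P hP).f q).hom ((iCocycles (coeffRep ι L ρ) q).hom z) := by
  change (cocyclesMap (MonoidHom.id Γ) (coaugHom ι L ρ P hP) q ≫ iCocycles _ q).hom z =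
    (iCocycles _ q ≫ (coaugCochains ι L ρ P hP).f q).hom z
  rw [HomologicalComplex.cyclesMap_i]

/-- The zig-zag `(w, 0, 0, …)` of the boundary double complex concentrated in column `0` and degree
`n` (`TwistedQuotient.IsBdryTrivialization` data; for a discrete building every boundary
trivialization may be taken of this form). [folklore] -/
def zigzagOfColumnZero (n : ℕ) (w : (inhomogeneousCochains (bdryRep ι L ρ P hP 0)).X n) :
    (p j : ℕ) → (inhomogeneousCochains (bdryRep ι L ρ P hP p)).X j
  | 0, j => if hj : j = n then hj ▸ w else 0
  | _ + 1, _ => 0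

/-- The column-`0` entry of the zig-zag in degree `n` is `w`. [folklore] -/
@[simp]
theorem zigzagOfColumnZero_zero_self (n : ℕ) (w : (inhomogeneousCochains (bdryRep ι L ρ P hP 0)).X n) :
    zigzagOfColumnZero ι L ρ P hP n w 0 n = w := by
  simp [zigzagOfColumnZero]

/-- The entries of the zig-zag in the columns `p ≥ 1` vanish. [folklore] -/
@[simp]
theorem zigzagOfColumnZero_succ (n : ℕ) (w : (inhomogeneousCochains (bdryRep ι L ρ P hP 0)).X n)
    (p j : ℕ) : zigzagOfColumnZero ι L ρ P hP n w (p + 1) j = 0 :=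
  rfl

/-- For an antichain `P`, the horizontal differential kills every entry of the zig-zag `(w, 0, 0, …)`
in degree `0`. [folklore] -/
theorem bdryDCochains_zigzagOfColumnZero_zero (hanti : ∀ x y : P, x ≤ y → x = y) (n : ℕ)
    (w : (inhomogeneousCochains (bdryRep ι L ρ P hP 0)).X n) (p : ℕ) :
    ((bdryDCochains ι L ρ P hP p).f 0).hom (zigzagOfColumnZero ι L ρ P hP n w p 0) = 0 := by
  cases p with
  | zero => exact bdryDCochains_zero_apply ι L ρ P hP hanti _ _
  | succ p => rw [zigzagOfColumnZero_succ, map_zero]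

/-- **Interior classes for a discrete building.**  If `P` is an antichain, a class
`x ∈ H^q(S_L, Ṽ)` is interior (admits a zig-zag in the boundary double complex,
`TwistedQuotient.IsInterior`) iff its restriction `r x ∈ H^q(Γ, Fun(N(P)₀ × 𝒢/L, V)) = H^q(∂S_L, Ṽ)`
vanishes: the zig-zag can be taken to be `(w, 0, 0, …)` with `δw = r z`, the first coface map being
zero.  This is `H^q_! = ker(H^q → H^q(∂))` for `GL₂`, where `∂(Γ\X̄) = ⊔_{Γ\ℙ¹(F)} Γ_b\e(B_b)`.
[cite: Harder1987, §1] [cite: Schwermer2010, §5.3] -/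
theorem isInterior_iff_bdryRestrict_eq_zero (hanti : ∀ x y : P, x ≤ y → x = y) (q : ℕ)
    (x : cohomology ι L ρ q) :
    IsInterior ι L ρ P hP q x ↔ (bdryRestrict ι L ρ P hP q).hom x = 0 := by
  constructor
  · rintro ⟨z, rfl, h, t⟩
    change (groupCohomology.π _ q ≫ bdryRestrict ι L ρ P hP q).hom z = 0
    rw [bdryRestrict, groupCohomology.π_map, ModuleCat.hom_comp, LinearMap.comp_apply,
      π_apply_eq_zero_iff_exists]
    exact ⟨h 0 (q - 1), by rw [t.start, iCocycles_cocyclesMap_coaugHom]⟩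
  · intro hx
    induction x using groupCohomology_induction_on with
    | h z =>
    change (groupCohomology.π _ q ≫ bdryRestrict ι L ρ P hP q).hom z = 0 at hx
    rw [bdryRestrict, groupCohomology.π_map, ModuleCat.hom_comp, LinearMap.comp_apply,
      π_apply_eq_zero_iff_exists] at hx
    obtain ⟨w, hw⟩ := hx
    refine ⟨z, rfl, zigzagOfColumnZero ι L ρ P hP (q - 1) w, ⟨?_, ?_, ?_⟩⟩
    · -- start: `δ w = r z`
      rw [zigzagOfColumnZero_zero_self, hw, iCocycles_cocyclesMap_coaugHom]
    · -- step: the only non-zero entry sits in column `0`, whose coface map vanishes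
      intro p j _
      cases p with
      | zero =>
        rw [zigzagOfColumnZero_succ, map_zero]
        exact bdryDCochains_zero_apply ι L ρ P hP hanti _ _
      | succ p => simp
    · -- stop
      exact bdryDCochains_zigzagOfColumnZero_zero ι L ρ P hP hanti _ _ _

/-- **`H^q_! = ker(r)` for a discrete building**: for an antichain `P`,
`x ∈ interiorCohomology ι L ρ P hP q ↔ r x = 0`. [cite: Harder1987, §1] [cite: Schwermer2010, §5.3] -/
theorem mem_interiorCohomology_iff_bdryRestrict_eq_zero (hanti : ∀ x y : P, x ≤ y → x = y) (q : ℕ)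
    (x : cohomology ι L ρ q) :
    x ∈ interiorCohomology ι L ρ P hP q ↔ (bdryRestrict ι L ρ P hP q).hom x = 0 :=
  isInterior_iff_bdryRestrict_eq_zero ι L ρ P hP hanti q x

/-- For a discrete building, a NON-interior class has NON-ZERO restriction to the boundary.
[cite: Harder1987, §1] -/
theorem bdryRestrict_ne_zero_of_not_mem_interiorCohomology (hanti : ∀ x y : P, x ≤ y → x = y)
    (q : ℕ) {x : cohomology ι L ρ q} (hx : x ∉ interiorCohomology ι L ρ P hP q) :
    (bdryRestrict ι L ρ P hP q).hom x ≠ 0 :=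
  fun h => hx ((mem_interiorCohomology_iff_bdryRestrict_eq_zero ι L ρ P hP hanti q x).mpr h)

end Antichain

end TwistedQuotient

end Literature.NumberTheory.Automorphic
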